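import Literature.NumberTheory.LFunctions.Zhang2022.Section3Lemma32Holds
import Literature.NumberTheory.LFunctions.PetrowYoungWeylBound
import HarnessLib

/-!
# Zhang (2022) §3, Lemma 3.2: the skeleton node `Lemma32` follows from the Petrow–Young Weyl bound
# (the campaign's FACT F-15, now a NAMED theorem-in-print)

Topic `Literature/NumberTheory/LFunctions/Zhang2022` (Landau–Siegel adjudication tree;
verdict-neutral). Y. Zhang, *Discrete mean estimates and the Landau–Siegel zero*,
arXiv:2211.02515v1 (2022) [Zhang2022LandauSiegel], §3, Lemma 3.2 (PDF p. 13; DAG node `Z22:Lem3.2`,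
skeleton decl `Skeleton.Lemma32` of `SkeletonPartOne.lean`).

The tree's `Skeleton.lemma32_holds_of_subconvexity` (`Section3Lemma32Holds.lean`) proves the node
GIVEN, as an explicit hypothesis binder, the Weyl-strength subconvexity bound "every primitive `θ`
to every modulus `q ≥ 1` satisfies `‖L(s,θ)‖ ≤ C · (q(1+|im s|))^{1/6+ε}` on `re s = ½`" for some
`0 ≤ ε < 1/12` — the campaign's frozen FACT F-15, cited there as [PetrowYoung2023, Thm 1.1] but not
named. That theorem in print is now the tree's NAMED FACT
`Literature.NumberTheory.LFunctions.petrowYoung2023_theorem11` (`PetrowYoungWeylBound.lean`;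
I. Petrow, M. P. Young, Duke Math. J. 172 (2023), Thm 1.1 [PetrowYoung2023]), whose proved
half-line form `petrowYoung2023_theorem11.halfLine` is that binder verbatim. This file records the
one-line consequence: **`petrowYoung2023_theorem11 → Skeleton.Lemma32`** — the §3 leaf of the
whole-DAG theorem `Skeleton.theorem1_of_leaves` is a theorem MODULO ONE THEOREM-IN-PRINT, with the
dependence on print now a single named `Prop` (status for the LS programme's E(d) registry:
`Lemma32` = theorem-in-tree given F-15 = theorem-in-print [PetrowYoung2023, Thm 1.1]).

Nothing here asserts the Petrow–Young theorem (it enters as the hypothesis `h`), and nothing is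
claimed about Theorems 1–2 of the manuscript or about Landau–Siegel zeros: the failing node of the
adjudication is `Margin232` (§18), not this §3 leaf. «The programme SEARCHES and TYPES; no claim
about Landau–Siegel zeros, Theorems 1–2 of arXiv:2211.02515 or a repaired Margin232 until a kernel
theorem says so.»

References: [Zhang2022LandauSiegel, §3 Lemma 3.2 p. 13]; [PetrowYoung2023, Thm 1.1]; tree
`Section3Lemma32Holds.lean` (`lemma32_holds_of_subconvexity`), `PetrowYoungWeylBound.lean`
(`petrowYoung2023_theorem11`, `.halfLine`), `Section3SubconvexInput.lean` (`saves_lemma32_weyl`: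
the exponent bookkeeping `μ = 1/6 < 1/4`).
-/

noncomputable section

namespace Literature.NumberTheory.LFunctions.Zhang2022.Skeleton

/-- **Lemma 3.2 of the manuscript from the Petrow–Young Weyl bound.** If every primitive Dirichlet
`L`-function satisfies `L(1/2+it,χ) ≪_ε (q(1+|t|))^{1/6+ε}` (the named fact
`petrowYoung2023_theorem11`, [PetrowYoung2023, Thm 1.1]), then the skeleton node `Lemma32`
(`Σ_{D⁴<n≤D⁸} ν(n)²τ₂(n)²/n ≪ 𝓛⁻²⁰⁰⁷` under (A), Zhang §3 Lemma 3.2) holds: instantiate the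
tree's `lemma32_holds_of_subconvexity` at `ε = 1/24 < 1/12` with the constant delivered by
`petrowYoung2023_theorem11.halfLine`. [cite: Zhang2022LandauSiegel, §3 Lemma 3.2 p. 13] -/
theorem lemma32_of_petrowYoung2023 (h : Literature.NumberTheory.LFunctions.petrowYoung2023_theorem11) :
    Lemma32 := by
  obtain ⟨C, hC⟩ := h.halfLine (ε := 1 / 24) (by norm_num)
  exact lemma32_holds_of_subconvexity (ε := 1 / 24) (C := C) (by norm_num) (by norm_num) hC

end Literature.NumberTheory.LFunctions.Zhang2022.Skeleton
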